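/-
Copyright: formalisation for the LaceExpansionHighD cell (what-if lane, kernel instance at `d := 10`).
Source formalised: R. Fitzner, R. van der Hofstad, *Mean-field behavior for nearest-neighbor percolation in d > 10*
(the NoBLE analysis), §5.1.1 (5.4)–(5.5) pp. 1089–1090, §5.1.2 (5.14), (5.16) p. 1092, Lemma 5.1 p. 1093, §5.3.3 p. 1098.
-/
import Literature.Probability.FitznerVanDerHofstad2017.SrwWPatternFarSqrtD10
import HarnessLib

/-!
# `W`-pattern evaluator over a POSITIONAL REFERENCE TABLE — kernel instance at `d := 10` (input certificate)

The collision-pattern evaluator of the orbit sum (5.16) (`SrwOrbitPatternLaw.srwW_vecOfParts_le_pdSum`) with the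
datum-wise majorant taken as the MONOTONE LOOKUP (`WPatD10.mluUpT`, Lemma 5.1 in the tail-count order, here with the
tail test up to `t = 12`) over an ARBITRARY certified reference table `tab : List (tail counts × value)`
(`RefValid l tab`: every row is witnessed by an antitone non-negative `b ∈ ℤ^10`, entries `≤ 12`, with the listed tail
counts and `I_{1,l}(b; 10) ≤ value`).  Reference rows are certified POSITIONALLY: for a descending parts list `b`
the kernel runs ONE fast law row `srwCountRowFast 10 L b` (forced once, `seqListNat`) and checks, for every listed
`(l, v)`, `Σ_{l ≤ i < L} p_i(vecOfParts 10 b; 10) + Ext(L) ≤ v` where `Ext(L) ≥ srwIZeroExtQ 10 44 (tabHi 1) L` is the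
extended origin column of the landed `L ≤ 44` origin table (`SrwOriginTailKernel.srwI_one_le_partialQ_add_extQ`:
`I_{1,l}(y) ≤ Σ_{l ≤ i < l+N} p_i(y) + I⁺_{1,l+N}(0)`, (5.14)).

* §1 `RefValid`, `srwI_le_mluUpT_ref` (soundness of the lookup over any valid table);
* §2 `T44`, `partialFrom`, `posFactsB`, `posValsB`, `posRowB`, `posTableB` (+ `_append`/`_cons`), `refRows prows l`
  (the reference table at index `l` read off the certified rows) and **`refValid_refRows`**;
* §3 the evaluator `wTermR`/`wPatSumR`/**`wPatQR j p tab`** and **`srwW_le_wPatQR`**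
  (`W_{1,j}(vecOfParts 10 p; 10) ≤ wPatQR j p tab` for `j ≤ 22`, `|p| ≤ 10`, `RefValid (2j) tab`);
* §4 table form `wPatLeTableR prows w rows` (+ chunking) and `srwW_le_of_wPatLeTableR`;
* §5 literal-`√` far rows against such a table: `farSqrtTableW` and `srwK_le_of_farSqrtTableW`
  (`WPatD10Far.sqrtCheck`, the landed `srwK_le_of_srwW_cert`).

Pointer language only: an input-certification kernel of the what-if lane; every table module instantiating it is a
kernel instance at `d := 10` (input certificate), no statement about any other dimension.
-/

set_option Elab.async false

namespace Literature.Probability.FitznerVanDerHofstad2017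

namespace WPatD10R

open Finset KTUD10 WPatD10 WPatD10Far
open SrwCount (coordD)

/-! ### §1. Validity of a reference table and soundness of the monotone lookup over it -/

/-- Semantics of `WPatD10.domL` (termwise `≤`, missing entries of the second list read as `0`). [folklore] -/
private theorem domL_getD' : ∀ (a b : List ℕ), domL a b = true → ∀ k, a.getD k 0 ≤ b.getD k 0
  | [], b, _, k => by simp
  | x :: xs, [], h, k => by
    simp only [domL, Bool.and_eq_true, beq_iff_eq] at h
    cases k with
    | zero => simp [h.1]
    | succ k => simpa using domL_getD' xs [] h.2 k
  | x :: xs, y :: ys, h, k => by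
    simp only [domL, Bool.and_eq_true, decide_eq_true_eq] at h
    cases k with
    | zero => simpa using h.1
    | succ k => simpa using domL_getD' xs ys h.2 k

/-- Invariant induction for `WPatD10.mluFold`. [folklore] -/
private theorem mluFold_induct' (tcs : List ℕ) (P : ℚ → Prop) :
    ∀ (tab : List (List ℕ × ℚ)) (acc : ℚ), P acc →
      (∀ ctv ∈ tab, domL ctv.1 tcs = true → P ctv.2) → P (mluFold tcs acc tab)
  | [], acc, hacc, _ => hacc
  | (ct, v) :: rest, acc, hacc, htab => by
    unfold mluFold
    refine mluFold_induct' tcs P rest _ ?_ fun ctv hmem => htab ctv (List.mem_cons_of_mem _ hmem)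
    split_ifs with h
    · simp only [Bool.and_eq_true, decide_eq_true_eq] at h
      exact htab (ct, v) List.mem_cons_self h.1
    · exact hacc

/-- **Validity of a reference table at the integral index `l`**: every row `(tail counts, value)` is witnessed by an
antitone non-negative `b ∈ ℤ^{10}` with entries `≤ 12`, the listed tail counts at `t = 1, …, 12`, and
`I_{1,l}(b; 10) ≤ value`. [cite: FitznerVanDerHofstad2016NoBLE, Lemma 5.1 p. 1093] -/
def RefValid (l : ℕ) (tab : List (List ℕ × ℚ)) : Prop :=
  ∀ ctv ∈ tab, ∃ b : Fin 10 → ℤ, Antitone b ∧ (∀ i, 0 ≤ b i) ∧ (∀ i, b i ≤ 12) ∧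
    (∀ k : ℕ, k < 12 → ctv.1.getD k 0 = absTailCount b ((k : ℤ) + 1)) ∧ srwI 10 1 l b ≤ ((ctv.2 : ℚ) : ℝ)

/-- The empty table is valid. [cite: FitznerVanDerHofstad2016NoBLE, Lemma 5.1 p. 1093] -/
theorem refValid_nil (l : ℕ) : RefValid l [] := fun _ h => by simp at h

/-- Concatenation of valid tables. [cite: FitznerVanDerHofstad2016NoBLE, Lemma 5.1 p. 1093] -/
theorem refValid_append {l : ℕ} {t₁ t₂ : List (List ℕ × ℚ)} (h₁ : RefValid l t₁) (h₂ : RefValid l t₂) :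
    RefValid l (t₁ ++ t₂) := fun ctv h => (List.mem_append.mp h).elim (h₁ ctv) (h₂ ctv)

/-- **Soundness of the monotone lookup over a valid reference table**: if `tcs` lists the tail counts of `z` at
`t = 1, …, 12` and `I_{1,l}(z) ≤ v₀`, then `I_{1,l}(z; 10) ≤ mluUpT tab v₀ tcs` (Lemma 5.1 in the tail-count order:
`SrwIntegralTailDom.srwI_le_of_absTailCount_le_upTo`, `T = 12`). [cite: FitznerVanDerHofstad2016NoBLE, Lemma 5.1 p. 1093] -/
theorem srwI_le_mluUpT_ref {l : ℕ} {tab : List (List ℕ × ℚ)} (htab : RefValid l tab) (z : Fin 10 → ℤ) {v₀ : ℚ}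
    (hv₀ : srwI 10 1 l z ≤ ((v₀ : ℚ) : ℝ)) (tcs : List ℕ)
    (htcs : ∀ k : ℕ, k < 12 → tcs.getD k 0 = absTailCount z ((k : ℤ) + 1)) :
    srwI 10 1 l z ≤ ((mluUpT tab v₀ tcs : ℚ) : ℝ) := by
  refine mluFold_induct' tcs (fun v => srwI 10 1 l z ≤ ((v : ℚ) : ℝ)) _ _ hv₀ ?_
  intro ctv hmem hdom
  obtain ⟨b, hanti, h0, h12, htail, hv⟩ := htab ctv hmem
  calc srwI 10 1 l z ≤ srwI 10 1 l b := by
        refine srwI_le_of_absTailCount_le_upTo le_rfl (by norm_num) l z b hanti h0 12 h12 fun t ht1 ht12 => ?_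
        obtain ⟨k, rfl⟩ : ∃ k : ℕ, t = (k : ℤ) + 1 := ⟨(t - 1).toNat, by omega⟩
        have hk : k < 12 := by omega
        rw [← htail k hk, ← htcs k hk]
        exact domL_getD' _ _ hdom k
    _ ≤ _ := hv

/-- The lookup value is non-negative when the start value is. [cite: FitznerVanDerHofstad2016NoBLE, Lemma 5.1 p. 1093] -/
theorem mluUpT_ref_nonneg {l : ℕ} {tab : List (List ℕ × ℚ)} (htab : RefValid l tab) {v₀ : ℚ}
    (hv₀ : (0 : ℝ) ≤ ((v₀ : ℚ) : ℝ)) (tcs : List ℕ) : (0 : ℝ) ≤ ((mluUpT tab v₀ tcs : ℚ) : ℝ) := by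
  refine mluFold_induct' tcs (fun v => (0 : ℝ) ≤ ((v : ℚ) : ℝ)) _ _ hv₀ ?_
  intro ctv hmem _
  obtain ⟨b, -, -, -, -, hv⟩ := htab ctv hmem
  exact (srwI_nonneg 1 (by norm_num) _ _).trans hv

/-! ### §2. Positional certification of reference rows (one fast law row per reference point) -/

/-- The landed one-sided origin column `I⁺_{1,l}(0; 10)`, `l ≤ 44` (`ITableD10L44.tabHi 1`, by name). [folklore] -/
def T44 : ℕ → ℚ := ITableD10L44.tabHi 1

/-- `I_{1,l}(0; 10) ≤ T44 l` for `l ≤ 44`. [cite: FitznerVanDerHofstad2016NoBLE, §5.1 (5.1) p. 1090] -/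
theorem T44_valid : ∀ l ≤ 44, srwI 10 1 l 0 ≤ ((T44 l : ℚ) : ℝ) :=
  fun l hl => (ITableD10L44.srwI_tab_encl_d10_origin 1 (by norm_num) l hl).2

/-- `Σ_{l ≤ i < L} row_i / 20^i` read off a law row (plumbing). [folklore] -/
def partialFrom (row : List ℕ) (l L : ℕ) : ℚ :=
  ((List.range (L - l)).map fun i => ((row.getD (l + i) 0 : ℕ) : ℚ) / (2 * ((10 : ℕ) : ℚ)) ^ (l + i)).sum

/-- `partialFrom (srwCountRowFast 10 L b) l L = srwLawPartialQ 10 b l (L − l)` (`l ≤ L`).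
[cite: FitznerVanDerHofstad2016NoBLE, §5.1.1 (5.4)–(5.5) pp. 1089–1090] -/
theorem partialFrom_eq (b : List ℕ) {l L : ℕ} (hl : l ≤ L) :
    partialFrom (srwCountRowFast 10 L b) l L = srwLawPartialQ 10 b l (L - l) := by
  unfold partialFrom srwLawPartialQ
  rw [Nat.add_sub_cancel' hl]

/-- `|coordD (vecOfParts 10 b) j| = b_j` (`0` beyond the list; `|b| ≤ 10`). [folklore] -/
private theorem natAbs_coordD_vecOfParts {b : List ℕ} (hb : b.length ≤ 10) (j : ℕ) :
    (coordD (vecOfParts 10 b) j).natAbs = b.getD j 0 := by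
  unfold coordD vecOfParts
  split_ifs with hj
  · simp
  · rw [List.getD_eq_default _ _ (by omega)]; rfl

/-- Boolean facts of a reference parts list `b` with claimed tail counts `tl`: `|b| ≤ 10`, `vecOfParts 10 b` antitone,
entries in `[0, 12]`, and `tl_k = #{μ : k+1 ≤ |b_μ|}` for `k < 12` (decided by evaluation; plumbing). [folklore] -/
def posFactsB (b tl : List ℕ) : Bool :=
  decide (b.length ≤ 10) &&
  (decide (∀ a c : Fin 10, a ≤ c → vecOfParts 10 b c ≤ vecOfParts 10 b a) &&
  (decide (∀ i : Fin 10, (0 : ℤ) ≤ vecOfParts 10 b i ∧ vecOfParts 10 b i ≤ 12) &&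
  decide (∀ k : Fin 12, tl.getD (k : ℕ) 0 = absTailCount (vecOfParts 10 b) (((k : ℕ) : ℤ) + 1))))

/-- Boolean value check of the listed `(l, v)`: ONE law row `srwCountRowFast 10 L b` (forced once), then
`l ≤ L ∧ Σ_{l ≤ i < L} p_i + ext ≤ v` for each pair (plumbing). [folklore] -/
def posValsB (b : List ℕ) (L : ℕ) (ext : ℚ) (lvs : List (ℕ × ℚ)) : Bool :=
  seqListNat (srwCountRowFast 10 L b) fun row =>
    lvs.all fun lv => decide (lv.1 ≤ L ∧ partialFrom row lv.1 L + ext ≤ lv.2)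

/-- A positional reference row: parts list `b` (descending), its tail counts at `t = 1..12`, and the certified
pairs `(l, v)` with `v ≥ I_{1,l}(vecOfParts 10 b; 10)`. [folklore] -/
abbrev PRow : Type := List ℕ × List ℕ × List (ℕ × ℚ)

/-- The row check: facts and values (plumbing). [folklore] -/
def posRowB (L : ℕ) (ext : ℚ) (r : PRow) : Bool := posFactsB r.1 r.2.1 && posValsB r.1 L ext r.2.2

/-- The table check: every row passes (plumbing). [folklore] -/
def posTableB (L : ℕ) (ext : ℚ) (prows : List PRow) : Bool := prows.all (posRowB L ext)

/-- Chunking of the table check. [cite: FitznerVanDerHofstad2016NoBLE, §5.3.3 p. 1098] -/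
theorem posTableB_append {L : ℕ} {ext : ℚ} {p₁ p₂ : List PRow} (h₁ : posTableB L ext p₁ = true)
    (h₂ : posTableB L ext p₂ = true) : posTableB L ext (p₁ ++ p₂) = true := by
  unfold posTableB at *
  rw [List.all_append, h₁, h₂]; rfl

/-- Consing a certified row. [cite: FitznerVanDerHofstad2016NoBLE, §5.3.3 p. 1098] -/
theorem posTableB_cons {L : ℕ} {ext : ℚ} {r : PRow} {rs : List PRow} (h₁ : posTableB L ext [r] = true)
    (h₂ : posTableB L ext rs = true) : posTableB L ext (r :: rs) = true :=
  posTableB_append (p₁ := [r]) h₁ h₂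

/-- A sub-table (filter) of a certified table is certified. [cite: FitznerVanDerHofstad2016NoBLE, §5.3.3 p. 1098] -/
theorem posTableB_filter {L : ℕ} {ext : ℚ} {ps : List PRow} (h : posTableB L ext ps = true) (q : PRow → Bool) :
    posTableB L ext (ps.filter q) = true := by
  unfold posTableB at *
  rw [List.all_eq_true] at h ⊢
  exact fun r hr => h r (List.mem_filter.mp hr).1

/-- **Soundness of one positional row** (`ext ≥` the extended origin column at `L`): every listed `(l, v)` has the
`RefValid` witness `vecOfParts 10 b` with `I_{1,l}(vecOfParts 10 b; 10) ≤ v` ((5.14): the law partial sum plus the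
origin tail, `srwI_one_le_partialQ_add_extQ`). [cite: FitznerVanDerHofstad2016NoBLE, §5.1.2 (5.14) p. 1092; Lemma 5.1 p. 1093] -/
theorem posRow_sound {L : ℕ} {ext : ℚ} (hext : srwIZeroExtQ 10 44 T44 L ≤ ext) {r : PRow}
    (h : posRowB L ext r = true) :
    ∀ lv ∈ r.2.2, ∃ b : Fin 10 → ℤ, Antitone b ∧ (∀ i, 0 ≤ b i) ∧ (∀ i, b i ≤ 12) ∧
      (∀ k : ℕ, k < 12 → r.2.1.getD k 0 = absTailCount b ((k : ℤ) + 1)) ∧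
      srwI 10 1 lv.1 b ≤ ((lv.2 : ℚ) : ℝ) := by
  intro lv hlv
  unfold posRowB posFactsB posValsB at h
  simp only [Bool.and_eq_true, decide_eq_true_eq, seqListNat_eq, List.all_eq_true] at h
  obtain ⟨⟨hlen, hanti, hrange, htail⟩, hvals⟩ := h
  obtain ⟨hl, hval⟩ := hvals lv hlv
  refine ⟨vecOfParts 10 r.1, fun a c hac => hanti a c hac, fun i => (hrange i).1, fun i => (hrange i).2,
    fun k hk => htail ⟨k, hk⟩, ?_⟩
  have hpos := srwI_one_le_partialQ_add_extQ (d := 10) (by norm_num) hlen (natAbs_coordD_vecOfParts hlen)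
    T44_valid lv.1 (L - lv.1)
  rw [Nat.add_sub_cancel' hl, ← partialFrom_eq r.1 hl] at hpos
  refine hpos.trans ?_
  have hq : partialFrom (srwCountRowFast 10 L r.1) lv.1 L + srwIZeroExtQ 10 44 T44 L ≤ lv.2 :=
    (add_le_add le_rfl hext).trans hval
  exact_mod_cast hq

/-- The reference table at the integral index `l` read off the positional rows: `(tail counts, v)` for every row
listing a pair `(l, v)`. [folklore] -/
def refRows (prows : List PRow) (l : ℕ) : List (List ℕ × ℚ) :=
  prows.filterMap fun r => (r.2.2.find? fun lv => lv.1 == l).map fun lv => (r.2.1, lv.2)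

/-- **A certified positional table yields a valid reference table at every index.**
[cite: FitznerVanDerHofstad2016NoBLE, §5.1.2 (5.14) p. 1092; Lemma 5.1 p. 1093] -/
theorem refValid_refRows {L : ℕ} {ext : ℚ} (hext : srwIZeroExtQ 10 44 T44 L ≤ ext) {prows : List PRow}
    (h : posTableB L ext prows = true) (l : ℕ) : RefValid l (refRows prows l) := by
  intro ctv hmem
  unfold refRows at hmem
  rw [List.mem_filterMap] at hmem
  obtain ⟨r, hr, hsome⟩ := hmem
  obtain ⟨lv, hfind, rfl⟩ := Option.map_eq_some_iff.mp hsome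
  have hlv : lv ∈ r.2.2 := List.mem_of_find?_eq_some hfind
  have hl : lv.1 = l := by simpa using List.find?_some hfind
  unfold posTableB at h
  rw [List.all_eq_true] at h
  obtain ⟨b, hanti, h0, h12, htail, hv⟩ := posRow_sound hext (h r hr) lv hlv
  exact ⟨b, hanti, h0, h12, htail, hl ▸ hv⟩

/-! ### §3. The evaluator over a reference table and its soundness -/

/-- Contribution of one collision datum: fibre weight × lookup of its tail-count profile (`t ≤ 12`, evaluation
order forced). [cite: FitznerVanDerHofstad2016NoBLE, (5.16) p. 1092] -/
def wTermR (tab : List (List ℕ × ℚ)) (v0 : ℚ) (p : List ℕ) (δ : List (Option (Fin p.length × Bool))) : ℚ :=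
  seqListNat (pdProfile p δ) fun prof =>
    seqListNat (tailsUpTo 12 prof) fun tcs => (pdWeightL 10 p.length δ : ℚ) * mluUpT tab v0 tcs

/-- Sum of `wTermR` over a list of data. [cite: FitznerVanDerHofstad2016NoBLE, (5.16) p. 1092] -/
def wPatSumR (tab : List (List ℕ × ℚ)) (v0 : ℚ) (p : List ℕ)
    (ds : List (List (Option (Fin p.length × Bool)))) : ℚ :=
  (ds.map (wTermR tab v0 p)).sum

/-- THE EVALUATOR `wPatQR j p tab ≥ W_{1,j}(vecOfParts 10 p; 10)` over a valid reference table at index `2j`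
(start value the origin column `iUp 1 j v0`). [cite: FitznerVanDerHofstad2016NoBLE, (5.16) p. 1092] -/
def wPatQR (j : ℕ) (p : List ℕ) (tab : List (List ℕ × ℚ)) : ℚ :=
  wPatSumR tab (iUp 1 j .v0) p (enumPD p.length p.length) / ((Nat.descFactorial 10 p.length : ℚ) * 2 ^ p.length)

/-- The cast of the pattern sum, termwise. [folklore] -/
private theorem cast_wPatSumR (tab : List (List ℕ × ℚ)) (v0 : ℚ) (p : List ℕ)
    (ds : List (List (Option (Fin p.length × Bool)))) :
    ((wPatSumR tab v0 p ds : ℚ) : ℝ) =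
      (ds.map fun δ => (pdWeightL 10 p.length δ : ℝ) *
        ((mluUpT tab v0 (tailsUpTo 12 (pdProfile p δ)) : ℚ) : ℝ)).sum := by
  induction ds with
  | nil => simp [wPatSumR]
  | cons δ rest ih =>
    unfold wPatSumR at ih ⊢
    rw [List.map_cons, List.sum_cons, Rat.cast_add, ih, List.map_cons, List.sum_cons]
    congr 1
    simp only [wTermR, seqListNat_eq]
    push_cast
    rfl

/-- **Soundness of the evaluator over a valid reference table**: `W_{1,j}(vecOfParts 10 p; 10) ≤ wPatQR j p tab` for
`j ≤ 22`, `|p| ≤ 10`, `RefValid (2j) tab` (the orbit law (5.16) in collision-pattern form, the profile law, and the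
lookup soundness `srwI_le_mluUpT_ref`). [cite: FitznerVanDerHofstad2016NoBLE, (5.16) p. 1092; Lemma 5.1 p. 1093] -/
theorem srwW_le_wPatQR {j : ℕ} (hj : j ≤ 22) (p : List ℕ) (hp : p.length ≤ 10) {tab : List (List ℕ × ℚ)}
    (htab : RefValid (2 * j) tab) : srwW 10 1 j (vecOfParts 10 p) ≤ ((wPatQR j p tab : ℚ) : ℝ) := by
  have hv0 : ∀ z : Fin 10 → ℤ, srwI 10 1 (2 * j) z ≤ ((iUp 1 j .v0 : ℚ) : ℝ) :=
    fun z => srwI_le_iUp_v0 le_rfl (by norm_num) hj z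
  have hv00 : (0 : ℝ) ≤ ((iUp 1 j .v0 : ℚ) : ℝ) := (srwI_nonneg 1 (by norm_num) _ _).trans (hv0 0)
  let g : List (Option (Fin p.length × Bool)) → ℝ := fun δ =>
    ((mluUpT tab (iUp 1 j .v0) (tailsUpTo 12 (pdProfile p δ)) : ℚ) : ℝ)
  have hg0 : ∀ δ, 0 ≤ g δ := fun δ => mluUpT_ref_nonneg htab hv00 _
  have hg : ∀ (κ : Fin p.length ↪ Fin 10) (s : Fin p.length → ℤˣ),
      srwI 10 1 (2 * j) (vecOfParts 10 p - sgnInjVec κ s fun i => (p.get i : ℤ)) ≤ g (pdatumL κ s) :=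
    fun κ s => srwI_le_mluUpT_ref htab _ (hv0 _) _ fun k hk => by
      rw [getD_tailsUpTo 12 _ k hk, ← card_filter_le_abs_vecOfParts_sub_sgnInjVec p hp κ s (k + 1) (by omega)]
      unfold absTailCount
      push_cast
      rfl
  refine (srwW_vecOfParts_le_pdSum (n := 1) (by norm_num) j p hp g hg0 hg).trans (le_of_eq ?_)
  rw [wPatQR, Rat.cast_div, cast_wPatSumR]
  push_cast
  rfl

/-! ### §4. Table-check form (chunkable) -/

/-- `wPatLeTableR prows w rows`: every row `(j, p)` has `wPatQR j p (refRows prows (2j)) ≤ w j p` (a `Bool`; one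
`decide +kernel` per chunk). [cite: FitznerVanDerHofstad2016NoBLE, (5.16) p. 1092; §5.3.3 p. 1098] -/
def wPatLeTableR (prows : List PRow) (w : ℕ → List ℕ → ℚ) (rows : List (ℕ × List ℕ)) : Bool :=
  rows.all fun r => decide (wPatQR r.1 r.2 (refRows prows (2 * r.1)) ≤ w r.1 r.2)

/-- Chunking a table check. [cite: FitznerVanDerHofstad2016NoBLE, §5.3.3 p. 1098] -/
theorem wPatLeTableR_append {prows : List PRow} {w : ℕ → List ℕ → ℚ} {r₁ r₂ : List (ℕ × List ℕ)}
    (h₁ : wPatLeTableR prows w r₁ = true) (h₂ : wPatLeTableR prows w r₂ = true) :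
    wPatLeTableR prows w (r₁ ++ r₂) = true := by
  unfold wPatLeTableR at *
  rw [List.all_append, h₁, h₂]; rfl

/-- Consing a certified row onto a certified table. [cite: FitznerVanDerHofstad2016NoBLE, §5.3.3 p. 1098] -/
theorem wPatLeTableR_cons {prows : List PRow} {w : ℕ → List ℕ → ℚ} {r : ℕ × List ℕ} {rs : List (ℕ × List ℕ)}
    (h₁ : wPatLeTableR prows w [r] = true) (h₂ : wPatLeTableR prows w rs = true) :
    wPatLeTableR prows w (r :: rs) = true :=
  wPatLeTableR_append (r₁ := [r]) h₁ h₂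

/-- **A certified table dominates `W_{1,j}(vecOfParts 10 p; 10)` on its rows** (`j ≤ 22`, `|p| ≤ 10`), given a
certified positional reference table (`posTableB`, `ext ≥` the extended origin column at `L`).
[cite: FitznerVanDerHofstad2016NoBLE, (5.16) p. 1092; Lemma 5.1 p. 1093] -/
theorem srwW_le_of_wPatLeTableR {L : ℕ} {ext : ℚ} (hext : srwIZeroExtQ 10 44 T44 L ≤ ext) {prows : List PRow}
    (hpt : posTableB L ext prows = true) {w : ℕ → List ℕ → ℚ} {rows : List (ℕ × List ℕ)}
    (h : wPatLeTableR prows w rows = true) :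
    ∀ r ∈ rows, r.1 ≤ 22 → r.2.length ≤ 10 → srwW 10 1 r.1 (vecOfParts 10 r.2) ≤ ((w r.1 r.2 : ℚ) : ℝ) := by
  intro r hr hj hp
  unfold wPatLeTableR at h
  rw [List.all_eq_true] at h
  have hle : wPatQR r.1 r.2 (refRows prows (2 * r.1)) ≤ w r.1 r.2 := of_decide_eq_true (h r hr)
  exact (srwW_le_wPatQR hj r.2 hp (refValid_refRows hext hpt (2 * r.1))).trans (by exact_mod_cast hle)

/-! ### §5. Literal-`√` far rows against a certified `W`-table -/

/-- Far rows `(κ, p, j, F)` checked against a `W`-table `w` on the certified index set `wrows`: the row `(j, p)` is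
certified and `sqrtCheck κ j (w j p) F` passes (plumbing). [folklore] -/
def farSqrtTableW (w : ℕ → List ℕ → ℚ) (wrows : List (ℕ × List ℕ)) (frs : List (ℕ × List ℕ × ℕ × ℚ)) : Bool :=
  frs.all fun f => decide ((f.2.2.1, f.2.1) ∈ wrows) && sqrtCheck f.1 f.2.2.1 (w f.2.2.1 f.2.1) f.2.2.2

/-- **Soundness of literal-`√` far rows**: `K_{1,κ}(vecOfParts 10 p; 10) ≤ F` on every row, given the `W`-table is
sound on `wrows` (input certificate; the landed `srwK_le_of_srwW_cert`).
[cite: FitznerVanDerHofstad2016NoBLE, §5.1.2 (5.16) p. 1092] -/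
theorem srwK_le_of_farSqrtTableW {w : ℕ → List ℕ → ℚ} {wrows : List (ℕ × List ℕ)}
    (hw : ∀ r ∈ wrows, srwW 10 1 r.1 (vecOfParts 10 r.2) ≤ ((w r.1 r.2 : ℚ) : ℝ))
    {frs : List (ℕ × List ℕ × ℕ × ℚ)} (h : farSqrtTableW w wrows frs = true) :
    ∀ f ∈ frs, srwK 10 1 f.1 (vecOfParts 10 f.2.1) ≤ ((f.2.2.2 : ℚ) : ℝ) := by
  intro f hf
  unfold farSqrtTableW at h
  rw [List.all_eq_true] at h
  have hrow := h f hf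
  rw [Bool.and_eq_true] at hrow
  obtain ⟨hmem, hchk⟩ := hrow
  exact srwK_le_of_sqrtCheck (hw (f.2.2.1, f.2.1) (of_decide_eq_true hmem)) hchk

end WPatD10R

end Literature.Probability.FitznerVanDerHofstad2017
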